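import Literature.NumberTheory.EllipticCurves.GoodReductionLangLift
import HarnessLib

/-!
# Inertia-invariant Hensel lift of a nonsingular point of the reduction of an `𝒪_w`-model
# (cell `b2b-bsdres`, team n1011, seat p10 GEN 8; THEOREM A programme, FILE 7b₁)

HONEST FRAMING (cell `b2b-bsdres`, run/shared/lean/b2b/bsd-rank1-residual/, verbatim in every
file): the goal of the cell is to DELETE the COMBINATION-SHAPED residual classes of the
Birch–Swinnerton-Dyer formula for ALL analytic-rank `≤ 1` elliptic curves over `ℚ` — "full BSD
formula for every rank `≤ 1` curve in class `C`" assembled STRICTLY from published theorems — so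
that the rank-`≤ 1` remainder becomes exactly the CONSTRUCTION-SHAPED classes, which are TYPED
(missing-input `Prop`s), NOT attempted. This is not "finishing BSD". Team n1011 (N10 / N11):
research route on the CONSTRUCTION-SHAPED class X4 (§I N11 LOWER half); no claim beyond the stated
classes; nothing is booked; marks UNCHANGED. Theorems only: no definition, no named fact, no
`sorry`. TOOL theorems; they close nothing by themselves.

## What

`exists_inertia_invariant_lift`: for a Weierstrass equation `W₀` over the valuation ring `𝒪_w`
of `K̄_v` whose coefficients are fixed by the inertia group `I_𝔐 ≤ Γ_{K_v}`, every NONSINGULAR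
point `(α₀, β₀)` of the reduced cubic `W₀ mod 𝔪_w` lifts to a point `(a, b)` of `W₀` with
`a, b ∈ 𝒪_w` FIXED BY `I_𝔐` (Teichmüller representative in one coordinate —
`exists_residue_eq_forall_inertia` — and Hensel at the non-vanishing partial derivative in the
other — `exists_isRoot_residue_eq_forall`, whose lifts are inertia-invariant). This is step (R5)
of the tree's `WeierstrassCurve.exists_lift_sub_mem_kernel` (good reduction, where every point of
the reduction is nonsingular), extracted verbatim as a lemma so that it serves singular
(additive) reduction as well (FILE 7b₂ `AdditiveReductionLangLift`).

References: [SilvermanAEC2009] VII.2.1 (surjectivity of `E₀(K) → Ẽ_ns(k)` by Hensel);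
[SerreLocalFields1979] IV §4 Prop. 16; [NeukirchANT1999] II §6.
-/

noncomputable section

open scoped Classical NNReal
open NumberField IsDedekindDomain Field Polynomial

universe u

namespace Summit.BirchSwinnertonDyer.Rank1Residual.GaloisImage.TwistedWitness

open WeierstrassCurve Literature.NumberTheory.EllipticCurves Literature.NumberTheory.GaloisRepresentations
  Literature.NumberTheory.GaloisRepresentations.IsNonarchimedeanLocalField
  IsDedekindDomain.HeightOneSpectrum

variable {K : Type u} [Field K] [NumberField K] {v : HeightOneSpectrum (𝓞 K)}
  {w : Valuation (AlgebraicClosure (v.adicCompletion K)) ℝ≥0}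
  (hw : ∀ x, (w x : ℝ) = spectralNorm (v.adicCompletion K) (AlgebraicClosure (v.adicCompletion K)) x)

include hw in
set_option maxHeartbeats 800000 in
/-- **Inertia-invariant Hensel lift of a nonsingular point of the reduction.** For `W₀` over
`𝒪_w` with `I_𝔐`-invariant coefficients and `(α₀, β₀)` nonsingular on `W₀ mod 𝔪_w`, there are
`a, b ∈ 𝒪_w` fixed by `I_𝔐` with `W₀(a, b) = 0`, `ā = α₀`, `b̄ = β₀`.
[cite: SilvermanAEC2009, Prop. VII.2.1] [cite: NeukirchANT1999, Ch. II §6 (Hensel's lemma)] -/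
theorem exists_inertia_invariant_lift {𝔐 : Ideal v.localAbsIntegers} (h𝔐 : 𝔐 ∈ v.localPrimesAbove)
    (W₀ : WeierstrassCurve w.integer)
    (hW₀I : ∀ τ ∈ 𝔐.inertia (absoluteGaloisGroup (v.adicCompletion K)),
      absoluteGaloisGroup.toAlgEquiv (v.adicCompletion K) τ (W₀.a₁ : AlgebraicClosure (v.adicCompletion K)) = W₀.a₁ ∧
      absoluteGaloisGroup.toAlgEquiv (v.adicCompletion K) τ (W₀.a₂ : AlgebraicClosure (v.adicCompletion K)) = W₀.a₂ ∧
      absoluteGaloisGroup.toAlgEquiv (v.adicCompletion K) τ (W₀.a₃ : AlgebraicClosure (v.adicCompletion K)) = W₀.a₃ ∧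
      absoluteGaloisGroup.toAlgEquiv (v.adicCompletion K) τ (W₀.a₄ : AlgebraicClosure (v.adicCompletion K)) = W₀.a₄ ∧
      absoluteGaloisGroup.toAlgEquiv (v.adicCompletion K) τ (W₀.a₆ : AlgebraicClosure (v.adicCompletion K)) = W₀.a₆)
    {α₀ β₀ : IsLocalRing.ResidueField w.integer}
    (hns : (W₀.map (IsLocalRing.residue w.integer)).toAffine.Nonsingular α₀ β₀) :
    ∃ a b : w.integer, W₀.toAffine.Equation a b ∧
      IsLocalRing.residue w.integer a = α₀ ∧ IsLocalRing.residue w.integer b = β₀ ∧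
      ∀ τ ∈ 𝔐.inertia (absoluteGaloisGroup (v.adicCompletion K)),
        absoluteGaloisGroup.toAlgEquiv (v.adicCompletion K) τ (a : AlgebraicClosure (v.adicCompletion K)) = a ∧
        absoluteGaloisGroup.toAlgEquiv (v.adicCompletion K) τ (b : AlgebraicClosure (v.adicCompletion K)) = b := by
  -- the subring of `𝒪_w` fixed by `I_𝔐`
  let S : Subring w.integer :=
    { carrier := {z | ∀ τ ∈ 𝔐.inertia (absoluteGaloisGroup (v.adicCompletion K)),
        absoluteGaloisGroup.toAlgEquiv (v.adicCompletion K) τ (z : AlgebraicClosure (v.adicCompletion K)) = z}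
      one_mem' := fun τ _ ↦ by simp
      zero_mem' := fun τ _ ↦ by simp
      add_mem' := fun {a b} ha hb τ hτ ↦ by
        simp only [Set.mem_setOf_eq] at ha hb
        rw [Subring.coe_add, map_add, ha τ hτ, hb τ hτ]
      mul_mem' := fun {a b} ha hb τ hτ ↦ by
        simp only [Set.mem_setOf_eq] at ha hb
        rw [Subring.coe_mul, map_mul, ha τ hτ, hb τ hτ]
      neg_mem' := fun {a} ha τ hτ ↦ by
        simp only [Set.mem_setOf_eq] at ha
        rw [Subring.coe_neg, map_neg, ha τ hτ] }
  have hSmem : ∀ z : w.integer, z ∈ S ↔ ∀ τ ∈ 𝔐.inertia (absoluteGaloisGroup (v.adicCompletion K)),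
      absoluteGaloisGroup.toAlgEquiv (v.adicCompletion K) τ (z : AlgebraicClosure (v.adicCompletion K)) = z :=
    fun _ ↦ Iff.rfl
  have ha₁S : W₀.a₁ ∈ S := fun τ hτ ↦ (hW₀I τ hτ).1
  have ha₂S : W₀.a₂ ∈ S := fun τ hτ ↦ (hW₀I τ hτ).2.1
  have ha₃S : W₀.a₃ ∈ S := fun τ hτ ↦ (hW₀I τ hτ).2.2.1
  have ha₄S : W₀.a₄ ∈ S := fun τ hτ ↦ (hW₀I τ hτ).2.2.2.1
  have ha₆S : W₀.a₆ ∈ S := fun τ hτ ↦ (hW₀I τ hτ).2.2.2.2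
  obtain ⟨heq, hpart⟩ := (Affine.nonsingular_iff' _ _).mp hns
  rw [Affine.equation_iff] at heq
  have ea₁ : (W₀.map (IsLocalRing.residue w.integer)).toAffine.a₁ = IsLocalRing.residue w.integer W₀.a₁ := rfl
  have ea₂ : (W₀.map (IsLocalRing.residue w.integer)).toAffine.a₂ = IsLocalRing.residue w.integer W₀.a₂ := rfl
  have ea₃ : (W₀.map (IsLocalRing.residue w.integer)).toAffine.a₃ = IsLocalRing.residue w.integer W₀.a₃ := rfl
  have ea₄ : (W₀.map (IsLocalRing.residue w.integer)).toAffine.a₄ = IsLocalRing.residue w.integer W₀.a₄ := rfl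
  have ea₆ : (W₀.map (IsLocalRing.residue w.integer)).toAffine.a₆ = IsLocalRing.residue w.integer W₀.a₆ := rfl
  rw [ea₁, ea₂, ea₃, ea₄, ea₆] at heq
  rw [ea₁, ea₂, ea₃, ea₄] at hpart
  by_cases hY : 2 * β₀ + IsLocalRing.residue w.integer W₀.a₁ * α₀ + IsLocalRing.residue w.integer W₀.a₃ ≠ 0
  · -- lift `α₀` invariantly, solve the monic quadratic in `Y` by Hensel
    obtain ⟨a, ha, haI⟩ := exists_residue_eq_forall_inertia hw h𝔐 α₀
    have haS : a ∈ S := haI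
    set c₁ : w.integer := W₀.a₁ * a + W₀.a₃ with hc₁
    set c₀ : w.integer := a ^ 3 + W₀.a₂ * a ^ 2 + W₀.a₄ * a + W₀.a₆ with hc₀
    have hc₁S : c₁ ∈ S := S.add_mem (S.mul_mem ha₁S haS) ha₃S
    have hc₀S : c₀ ∈ S := S.add_mem (S.add_mem (S.add_mem (S.pow_mem haS 3)
      (S.mul_mem ha₂S (S.pow_mem haS 2))) (S.mul_mem ha₄S haS)) ha₆S
    set f : (w.integer)[X] := X ^ 2 + C c₁ * X - C c₀ with hf
    have hfmonic : f.Monic := by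
      rw [hf, sub_eq_add_neg, add_assoc]
      refine (monic_X_pow 2).add_of_left ?_
      refine (degree_add_le _ _).trans_lt (max_lt ?_ ?_)
      · exact (degree_C_mul_X_le _).trans_lt (by rw [degree_X_pow]; norm_num)
      · rw [degree_neg]; exact (degree_C_le).trans_lt (by rw [degree_X_pow]; norm_num)
    have hfcoeff : ∀ i, f.coeff i ∈ S := by
      intro i
      rw [hf]
      simp only [coeff_add, coeff_sub, coeff_X_pow, coeff_C_mul, coeff_X, coeff_C]
      refine S.sub_mem (S.add_mem ?_ (S.mul_mem hc₁S ?_)) ?_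
      · split_ifs
        · exact S.one_mem
        · exact S.zero_mem
      · split_ifs
        · exact S.one_mem
        · exact S.zero_mem
      · split_ifs
        · exact hc₀S
        · exact S.zero_mem
    have hroot : (f.map (IsLocalRing.residue w.integer)).IsRoot β₀ := by
      rw [IsRoot.def, eval_map, hf]
      simp only [eval₂_add, eval₂_sub, eval₂_mul, eval₂_pow, eval₂_C, eval₂_X, hc₁, hc₀, map_add,
        map_mul, map_pow, ha]
      linear_combination heq
    have hder : (f.map (IsLocalRing.residue w.integer)).derivative.eval β₀ ≠ 0 := by
      have : (f.map (IsLocalRing.residue w.integer)).derivative.eval β₀ =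
          2 * β₀ + IsLocalRing.residue w.integer W₀.a₁ * α₀ + IsLocalRing.residue w.integer W₀.a₃ := by
        rw [derivative_map, eval_map, hf]
        simp only [derivative_sub, derivative_X_pow, derivative_mul, derivative_C,
          derivative_X, zero_mul, zero_add, mul_one, sub_zero, eval₂_add, eval₂_mul, eval₂_ofNat,
          mul_zero, add_zero, eval₂_C, eval₂_X, hc₁, map_add, map_mul, ha, map_ofNat, Nat.cast_ofNat,
          pow_one, Nat.add_one_sub_one]
        ring
      rw [this]; exact hY
    obtain ⟨b, hb, hbβ, hbI⟩ := exists_isRoot_residue_eq_forall (v := v) f hfmonic β₀ hroot hder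
    have hbS : b ∈ S := fun τ hτ ↦ hbI _ (fun z ↦ spectralValuation_smul hw τ z)
      ((mem_inertia_iff_spectralValuation hw h𝔐).mp hτ) (fun i ↦ hfcoeff i τ hτ)
    have hWab : W₀.toAffine.Equation a b := by
      rw [Affine.equation_iff]
      rw [IsRoot.def, hf] at hb
      simp only [eval_add, eval_sub, eval_mul, eval_pow, eval_X, eval_C, hc₁, hc₀] at hb
      linear_combination hb
    exact ⟨a, b, hWab, ha, hbβ, fun τ hτ ↦ ⟨haS τ hτ, hbS τ hτ⟩⟩
  · -- lift `β₀` invariantly, solve the monic cubic in `X` by Hensel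
    have hXp : IsLocalRing.residue w.integer W₀.a₁ * β₀ -
        (3 * α₀ ^ 2 + 2 * IsLocalRing.residue w.integer W₀.a₂ * α₀ + IsLocalRing.residue w.integer W₀.a₄) ≠ 0 := by
      rw [not_not] at hY
      exact hpart.resolve_right (by rw [hY]; exact not_not.mpr rfl)
    obtain ⟨b, hb, hbI⟩ := exists_residue_eq_forall_inertia hw h𝔐 β₀
    have hbS : b ∈ S := hbI
    set c₂ : w.integer := W₀.a₂ with hc₂
    set c₁ : w.integer := W₀.a₄ - W₀.a₁ * b with hc₁
    set c₀ : w.integer := W₀.a₆ - b ^ 2 - W₀.a₃ * b with hc₀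
    have hc₂S : c₂ ∈ S := ha₂S
    have hc₁S : c₁ ∈ S := S.sub_mem ha₄S (S.mul_mem ha₁S hbS)
    have hc₀S : c₀ ∈ S := S.sub_mem (S.sub_mem ha₆S (S.pow_mem hbS 2)) (S.mul_mem ha₃S hbS)
    set g : (w.integer)[X] := X ^ 3 + C c₂ * X ^ 2 + C c₁ * X + C c₀ with hg
    have hgmonic : g.Monic := by
      rw [hg, add_assoc, add_assoc]
      refine (monic_X_pow 3).add_of_left ?_
      refine (degree_add_le _ _).trans_lt (max_lt ?_ ((degree_add_le _ _).trans_lt (max_lt ?_ ?_)))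
      · exact (degree_C_mul_X_pow_le 2 _).trans_lt (by rw [degree_X_pow]; norm_num)
      · exact (degree_C_mul_X_le _).trans_lt (by rw [degree_X_pow]; norm_num)
      · exact (degree_C_le).trans_lt (by rw [degree_X_pow]; norm_num)
    have hgcoeff : ∀ i, g.coeff i ∈ S := by
      intro i
      rw [hg]
      simp only [coeff_add, coeff_X_pow, coeff_C_mul, coeff_X, coeff_C]
      refine S.add_mem (S.add_mem (S.add_mem ?_ (S.mul_mem hc₂S ?_)) (S.mul_mem hc₁S ?_)) ?_
      · split_ifs
        · exact S.one_mem
        · exact S.zero_mem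
      · split_ifs
        · exact S.one_mem
        · exact S.zero_mem
      · split_ifs
        · exact S.one_mem
        · exact S.zero_mem
      · split_ifs
        · exact hc₀S
        · exact S.zero_mem
    have hroot : (g.map (IsLocalRing.residue w.integer)).IsRoot α₀ := by
      rw [IsRoot.def, eval_map, hg]
      simp only [eval₂_add, eval₂_sub, eval₂_mul, eval₂_pow, eval₂_C, eval₂_X, hc₂, hc₁, hc₀,
        map_sub, map_mul, map_pow, hb]
      linear_combination -heq
    have hder : (g.map (IsLocalRing.residue w.integer)).derivative.eval α₀ ≠ 0 := by
      have : (g.map (IsLocalRing.residue w.integer)).derivative.eval α₀ =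
          -(IsLocalRing.residue w.integer W₀.a₁ * β₀ -
            (3 * α₀ ^ 2 + 2 * IsLocalRing.residue w.integer W₀.a₂ * α₀ + IsLocalRing.residue w.integer W₀.a₄)) := by
        rw [derivative_map, eval_map, hg]
        simp only [derivative_add, derivative_X_pow, derivative_mul, derivative_C,
          derivative_X, zero_mul, zero_add, mul_one, add_zero, eval₂_add, eval₂_sub, eval₂_mul, eval₂_ofNat,
          mul_zero, sub_zero, eval₂_C, eval₂_X, eval₂_pow, hc₂, hc₁, map_sub, map_mul, hb, map_ofNat,
          Nat.cast_ofNat, pow_one, Nat.add_one_sub_one]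
        ring
      rw [this, neg_ne_zero]; exact hXp
    obtain ⟨a, ha, haα, haI⟩ := exists_isRoot_residue_eq_forall (v := v) g hgmonic α₀ hroot hder
    have haS : a ∈ S := fun τ hτ ↦ haI _ (fun z ↦ spectralValuation_smul hw τ z)
      ((mem_inertia_iff_spectralValuation hw h𝔐).mp hτ) (fun i ↦ hgcoeff i τ hτ)
    have hWab : W₀.toAffine.Equation a b := by
      rw [Affine.equation_iff]
      rw [IsRoot.def, hg] at ha
      simp only [eval_add, eval_mul, eval_pow, eval_X, eval_C, hc₂, hc₁, hc₀] at ha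
      linear_combination -ha
    exact ⟨a, b, hWab, haα, hb, fun τ hτ ↦ ⟨haS τ hτ, hbS τ hτ⟩⟩

end Summit.BirchSwinnertonDyer.Rank1Residual.GaloisImage.TwistedWitness

end
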